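import Summits.Ventures.HodgeRepro.NightOpenInputs
import Summits.Ventures.HodgeRepro.Groups
import Summits.Ventures.HodgeRepro.Primitive

/-!
# The reduced dimension `dim B_red` of a face on the kernel — and `dim B_red = 4` for every census face of degree 6

Blind re-derivation cell `pub-hodge-repro`, seat `night-4` (ROUTE HARDENING for the Monday FINAL, gen 1).  Target tree path
`lean/Summits/Ventures/HodgeRepro/Night4ReducedDimSix.lean`.

`route/ROUTE.md` (v2.88) §3.2 counts, for the degree-6 Galois CM field: "Every face has three primitive corners (translates
of one A) and one k-lift corner … Lemma R: B_red = A × E, an abelian FOURFOLD".  `Night4KnownRegime.lean` carries that count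
as the named hypothesis `ReducedFourfold_deg6`.  This file puts its COMBINATORIAL content on the kernel:

* `rclass T` — the right-translation class `{T·h}` of a CM type (the isogeny class of the corner `A_T`: twisting the
  `F`-action changes the type by right translation, ROUTE.md §0 / Deligne endnote M.12);
* `simpleDim T = [F:ℚ] / (2 |rstab T|)` — the dimension of the simple CM abelian variety underlying `A_T` (a type with right
  stabiliser `H` is induced from the CM subfield `F^H` of degree `[F:ℚ]/|H|`, and `A_T` is isogenous to a power of the
  simple variety of that induced type — Shimura 1998 §8.3, ROUTE.md §4 item 1 (R0));
* `redDim T = Σ_{classes} simpleDim` for a family of four corner types, and `TypeDatum.redDim D Δ` for a face `Δ ⊂ S` on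
  the `G`-set model (corner types `φ_s = liftedType s`), with `TypeDatum.redDim_prodDatum` identifying the two on the
  product datum of `NightOpenInputs.lean` (T8);
* `redDim_faceCorners_C6` — KERNEL (`decide +kernel`): for EVERY CM type `Φ` of `C6 = Multiplicative (ZMod 6)` and every
  pair of distinct places, `redDim (faceCorners cc_C6 Φ p p') = 4`; `redDim_prodDatum_faceCorners_C6` — the same for the
  roster's face `diagFour` on the product datum.

What this does NOT do: it does not identify the interface's `dim (reduced A Δ)` with `redDim` (that identification —
`B_red = ∏_j A_j` over the classes with `dim A_j = [F:ℚ]/(2|rstab|)` — is the cell's dictionary, carried as the hypothesis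
`DimReduced` of the route-level split in `Night4ReducedDimRoute.lean`), and it does not transport the `C6` count to an
abstract group of order 6 (p6's classification + p1's `isFace_of_sumTwo_of_card_le_eight` would do that; not composed here).
Nothing here says anything about the status of the Hodge conjecture for CM abelian varieties, which is NOT proved.
-/

set_option autoImplicit false

open Finset

namespace HodgeRepro

section Model

variable {G : Type} [Group G] [Fintype G] [DecidableEq G]

/-- The right-translation class `{T·h : h ∈ G}` of a CM type `T` — the isogeny class of the corner `A_T` up to the choice
of the `F`-action (ROUTE.md §0: "twisting the CM structure of A_T by g ∈ G … changes the type by RIGHT translation T·g …,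
so the isogeny class of A_T is its right-translation orbit"). -/
def rclass (T : Finset G) : Finset (Finset G) := univ.image (rmul T)

/-- `simpleDim T = [F:ℚ] / (2 |rstab T|)`: the dimension of the simple CM abelian variety of the type induced on
`F^{rstab T}` from which `T` is lifted (`A_T` is isogenous to its `|rstab T|`-th power). -/
def simpleDim (T : Finset G) : ℕ := Fintype.card G / (2 * Fintype.card (rstab T))

/-- The reduced dimension `dim B_red = Σ_{classes} dim A_j` of a family of four corner types (ROUTE.md §1 row S3ᴿ:
"the corners sorted into isogeny classes A_1, …, A_m … B_red := ∏_j A_j"): one summand per distinct right-translation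
class (the pair `(rclass, simpleDim)` is constant on a class, so the image de-duplicates exactly the classes). -/
def redDim (T : Fin 4 → Finset G) : ℕ :=
  (univ.image fun i => (rclass (T i), simpleDim (T i))).sum Prod.snd

end Model

namespace Route

/-- The reduced dimension of a subset `Δ ⊂ S` on the `G`-set model: the corner types are the lifted types `φ_s`, `s ∈ Δ`. -/
def TypeDatum.redDim (D : TypeDatum) (Δ : Finset D.S) : ℕ :=
  (Δ.image fun s => (rclass (D.liftedType s), simpleDim (D.liftedType s))).sum Prod.snd

variable {G : Type} [Group G] [Fintype G] [DecidableEq G] {c : G} (hc : IsComplexConj c) (T : Fin 4 → Finset G)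

/-- On the product datum of `NightOpenInputs.lean` (the CM algebra `F⁴` with the corner types `T i`), the reduced dimension
of the roster's face `diagFour` is `redDim T`. -/
theorem TypeDatum.redDim_prodDatum (hT : ∀ i, IsCMType c (T i)) :
    (TypeDatum.prodDatum hc T hT).redDim diagFour = HodgeRepro.redDim T := by
  have h : ((diagFour : Finset (Σ _ : Fin 4, G)).image fun s : (Σ _ : Fin 4, G) =>
      (rclass ((TypeDatum.prodDatum hc T hT).liftedType s), simpleDim ((TypeDatum.prodDatum hc T hT).liftedType s)))
      = univ.image fun i : Fin 4 => (rclass (T i), simpleDim (T i)) := by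
    rw [diagFour, Finset.image_image]
    exact Finset.image_congr fun i _ => by
      rw [Function.comp_apply, TypeDatum.liftedType_prodDatum]
      rfl
  exact congrArg (fun s => s.sum Prod.snd) h

end Route

/-! ## Degree 6: every census face has `dim B_red = 4` — on the kernel -/

/-- **Every census face of the degree-6 cyclic CM field has reduced dimension 4** (ROUTE.md §3.2: `B_red = A × E`; night-1's
FACES6-TABLE: classes 2, stabiliser orders `[1, 3]`, simple dimensions `[3, 1]`, `g = 4`): for every CM type `Φ` of
`C6` and every two distinct places `p, p'`, `redDim (faceCorners cc_C6 Φ p p') = 4`.  KERNEL (`decide +kernel` over the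
64 subsets and 36 pairs of places). -/
theorem redDim_faceCorners_C6 (Φ : Finset C6) (p p' : C6) (hΦ : IsCMType cc_C6 Φ) (hp : p' ∉ place cc_C6 p) :
    redDim (faceCorners cc_C6 Φ p p') = 4 := by
  revert Φ p p'
  decide +kernel

/-- The same on the roster's face: the product datum of the census face `(Φ; p, p')` of `C6` has
`TypeDatum.redDim diagFour = 4`. -/
theorem Route.redDim_prodDatum_faceCorners_C6 (Φ : Finset C6) (p p' : C6) (hΦ : IsCMType cc_C6 Φ)
    (hp : p' ∉ place cc_C6 p) :
    (Route.TypeDatum.prodDatum cc_C6_isComplexConj (faceCorners cc_C6 Φ p p')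
      (isCMType_faceCorners cc_C6_isComplexConj hΦ p p')).redDim Route.diagFour = 4 := by
  rw [Route.TypeDatum.redDim_prodDatum]
  exact redDim_faceCorners_C6 Φ p p' hΦ hp

end HodgeRepro
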